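import Mathlib
import Literature.Analysis.FluidPDE.AxisymNoSwirlScalarEq
import HarnessLib.Audit
import HarnessLib

/-!
# L3TimeExponentPincer — ring datum calculus I: the Laplacian of a radial profile and of the
# azimuthal potential `F(|x|²) · Jx`

Support kernel for the crux `L3CascadeJaw` (item stmt-NavierStokesRegularity-19499): first
calculus step of the explicit ring datum required by `lpPersistence_of_ringData`
(`L3TimeExponentPincerRingPersistence`).  For a profile `F ∈ C²(ℝ)` and `s = |x|²` on `ℝ³`:

* `fderiv_comp_norm_sq_apply` — `D(F(|·|²))(x) v = F'(|x|²) · 2⟪x, v⟫`;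
* `laplacian_comp_norm_sq` — `Δ(F(|x|²)) = 4|x|² F''(|x|²) + 6 F'(|x|²)`;
* `laplacian_comp_norm_sq_smul_rotGen` — `Δ(F(|x|²) Jx) = (4|x|² F''(|x|²) + 10 F'(|x|²)) Jx`
  (`Jx = rotGen x = (−x₁, x₀, 0)`; tree `laplacian_smul_rotGen`: `Δ(fJ) = (Δf)J + 2J(∇f)` and
  `∇(F(|x|²)) = 2F'(|x|²) x`).

With `div (F(|x|²) J) = 0` this gives `curl curl (F(|x|²) J) = −(4sF'' + 10F')(|x|²) J`, i.e. the
vortex-ring datum `u₀ = curl (F(|x|²) J)` has `ω_θ/r = −(4sF'' + 10F')(|x|²)`, a RADIAL function —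
`≡ 0` exactly where `F(s) = s^{-3/2}` (the dipole), the design principle of the smooth Hill-type
ring. WHAT THIS IS NOT: pure calculus; no fluid statement.
-/

namespace Summit.NavierStokesRegularity.NavierStokesRegularity.Theorems.L3TimeExponentPincerRingDatumLaplacian

open Real Literature.Analysis.FluidPDE InnerProductSpace
open scoped Laplacian RealInnerProductSpace

variable {F : ℝ → ℝ}

/-- `D(F(|·|²))(x) v = F'(|x|²) · (2⟪x, v⟫)`. -/
theorem hasFDerivAt_comp_norm_sq (hF : Differentiable ℝ F) (x : EuclideanSpace ℝ (Fin 3)) :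
    HasFDerivAt (fun y : EuclideanSpace ℝ (Fin 3) => F (‖y‖ ^ 2))
      (deriv F (‖x‖ ^ 2) • ((2 : ℕ) • innerSL ℝ x)) x := by
  have h1 : HasFDerivAt (fun y : EuclideanSpace ℝ (Fin 3) => ‖y‖ ^ 2) ((2 : ℕ) • innerSL ℝ x) x :=
    (hasStrictFDerivAt_norm_sq x).hasFDerivAt
  exact (hF (‖x‖ ^ 2)).hasDerivAt.comp_hasFDerivAt x h1

/-- Applied form: `D(F(|·|²))(x) v = F'(|x|²) · (2⟪x, v⟫)`. -/
theorem fderiv_comp_norm_sq_apply (hF : Differentiable ℝ F) (x v : EuclideanSpace ℝ (Fin 3)) :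
    fderiv ℝ (fun y : EuclideanSpace ℝ (Fin 3) => F (‖y‖ ^ 2)) x v = deriv F (‖x‖ ^ 2) * (2 * ⟪x, v⟫) := by
  rw [(hasFDerivAt_comp_norm_sq hF x).fderiv, _root_.smul_apply, _root_.smul_apply, innerSL_apply_apply,
    nsmul_eq_mul, smul_eq_mul]
  push_cast
  ring

/-- The partial derivative along `eᵢ`: `∂ᵢ(F(|·|²))(x) = 2 xᵢ F'(|x|²)`. -/
theorem fderiv_comp_norm_sq_single (hF : Differentiable ℝ F) (x : EuclideanSpace ℝ (Fin 3)) (i : Fin 3) :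
    fderiv ℝ (fun y : EuclideanSpace ℝ (Fin 3) => F (‖y‖ ^ 2)) x (EuclideanSpace.single i 1) =
      2 * x i * deriv F (‖x‖ ^ 2) := by
  rw [fderiv_comp_norm_sq_apply hF, EuclideanSpace.inner_single_right]
  simp only [one_mul, conj_trivial]
  ring

/-- The second partial: `∂ᵢ∂ᵢ(F(|·|²))(x) = 4 xᵢ² F''(|x|²) + 2 F'(|x|²)` for `F ∈ C²`. -/
theorem fderiv_fderiv_comp_norm_sq_single (hF : ContDiff ℝ 2 F) (x : EuclideanSpace ℝ (Fin 3)) (i : Fin 3) :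
    fderiv ℝ (fun y : EuclideanSpace ℝ (Fin 3) => fderiv ℝ (fun z : EuclideanSpace ℝ (Fin 3) => F (‖z‖ ^ 2)) y
        (EuclideanSpace.single i 1)) x (EuclideanSpace.single i 1) =
      4 * x i ^ 2 * deriv (deriv F) (‖x‖ ^ 2) + 2 * deriv F (‖x‖ ^ 2) := by
  have hF1 : Differentiable ℝ F := hF.differentiable (by norm_num)
  have hF' : Differentiable ℝ (deriv F) := by
    have h1 : ContDiff ℝ 1 (deriv F) := ContDiff.deriv' (n := 1) (by exact_mod_cast hF)
    exact h1.differentiable one_ne_zero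
  -- rewrite the inner function
  have e : (fun y : EuclideanSpace ℝ (Fin 3) => fderiv ℝ (fun z : EuclideanSpace ℝ (Fin 3) => F (‖z‖ ^ 2)) y
      (EuclideanSpace.single i 1)) = fun y => (2 * y i) * deriv F (‖y‖ ^ 2) := by
    funext y; rw [fderiv_comp_norm_sq_single hF1]
  rw [e]
  -- product rule
  have hc : HasFDerivAt (fun y : EuclideanSpace ℝ (Fin 3) => 2 * y i)
      ((2 : ℝ) • (EuclideanSpace.proj i : EuclideanSpace ℝ (Fin 3) →L[ℝ] ℝ)) x := by
    have := ((EuclideanSpace.proj i : EuclideanSpace ℝ (Fin 3) →L[ℝ] ℝ).hasFDerivAt (x := x)).const_mul (2 : ℝ)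
    simpa using this
  have hg : HasFDerivAt (fun y : EuclideanSpace ℝ (Fin 3) => deriv F (‖y‖ ^ 2))
      (deriv (deriv F) (‖x‖ ^ 2) • ((2 : ℕ) • innerSL ℝ x)) x := hasFDerivAt_comp_norm_sq hF' x
  rw [fderiv_fun_mul hc.differentiableAt hg.differentiableAt, hc.fderiv, hg.fderiv]
  have hp : (EuclideanSpace.proj i : EuclideanSpace ℝ (Fin 3) →L[ℝ] ℝ) (EuclideanSpace.single i 1) = 1 := by
    show (EuclideanSpace.single i (1 : ℝ) : EuclideanSpace ℝ (Fin 3)) i = 1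
    simp
  simp only [_root_.add_apply, _root_.smul_apply, smul_eq_mul, innerSL_apply_apply,
    EuclideanSpace.inner_single_right, one_mul, mul_one, conj_trivial, nsmul_eq_mul, hp]
  push_cast
  ring

/-- **The Laplacian of a radial profile on `ℝ³`**: `Δ(F(|x|²)) = 4|x|² F''(|x|²) + 6 F'(|x|²)`. -/
theorem laplacian_comp_norm_sq (hF : ContDiff ℝ 2 F) (x : EuclideanSpace ℝ (Fin 3)) :
    (Δ (fun y : EuclideanSpace ℝ (Fin 3) => F (‖y‖ ^ 2))) x =
      4 * ‖x‖ ^ 2 * deriv (deriv F) (‖x‖ ^ 2) + 6 * deriv F (‖x‖ ^ 2) := by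
  have hf : ContDiff ℝ 2 (fun y : EuclideanSpace ℝ (Fin 3) => F (‖y‖ ^ 2)) :=
    hF.comp (contDiff_norm_sq ℝ)
  rw [laplacian_eq_sum_fderiv_fderiv (EuclideanSpace.basisFun (Fin 3) ℝ) hf x]
  simp only [EuclideanSpace.basisFun_apply, Fin.sum_univ_three, fderiv_fderiv_comp_norm_sq_single hF]
  have hn : ‖x‖ ^ 2 = x 0 ^ 2 + x 1 ^ 2 + x 2 ^ 2 := by
    rw [EuclideanSpace.norm_sq_eq, Fin.sum_univ_three]
    simp only [Real.norm_eq_abs, sq_abs]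
  rw [hn]
  ring

/-- **The Laplacian of the azimuthal potential `F(|x|²) Jx`**:
`Δ(F(|x|²) J)(x) = (4|x|² F''(|x|²) + 10 F'(|x|²)) · Jx`. -/
theorem laplacian_comp_norm_sq_smul_rotGen (hF : ContDiff ℝ 2 F) (x : EuclideanSpace ℝ (Fin 3)) :
    (Δ (fun y : EuclideanSpace ℝ (Fin 3) => F (‖y‖ ^ 2) • rotGen y)) x =
      (4 * ‖x‖ ^ 2 * deriv (deriv F) (‖x‖ ^ 2) + 10 * deriv F (‖x‖ ^ 2)) • rotGen x := by
  have hf : ContDiff ℝ 2 (fun y : EuclideanSpace ℝ (Fin 3) => F (‖y‖ ^ 2)) :=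
    hF.comp (contDiff_norm_sq ℝ)
  have hF1 : Differentiable ℝ F := hF.differentiable (by norm_num)
  rw [laplacian_smul_rotGen hf x, laplacian_comp_norm_sq hF x]
  -- `∇(F(|x|²)) = 2F'(|x|²) x`, so `J(∇f) = 2F' Jx`
  have hgrad : gradient (fun y : EuclideanSpace ℝ (Fin 3) => F (‖y‖ ^ 2)) x =
      (2 * deriv F (‖x‖ ^ 2)) • x := by
    refine ext_inner_right ℝ fun w => ?_
    rw [gradient, InnerProductSpace.toDual_symm_apply, fderiv_comp_norm_sq_apply hF1,
      real_inner_smul_left]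
    ring
  rw [hgrad, rotGen_smul, smul_smul, ← add_smul]
  congr 1
  ring

end Summit.NavierStokesRegularity.NavierStokesRegularity.Theorems.L3TimeExponentPincerRingDatumLaplacian
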